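/-
Copyright: cell pub-balaban-gaps, seat ne8 (estimate NE7c), gen 17. Project licence.
-/
import Mathlib.MeasureTheory.Measure.Haar.InnerProductSpace
import Mathlib.MeasureTheory.Measure.Lebesgue.VolumeOfBalls
import Mathlib.MeasureTheory.Constructions.Pi

/-!
# The Lebesgue volume of a SOLID CYLINDER over a unit direction of a Euclidean space: `vol{x : ‖x − ⟪x,e⟫e‖ ≤ ρ, ⟪x,e⟫ ∈ J} = vol(J)·ω_n·ρ^n`,
# `dim = n + 1` — step B2 of VALUING the small-ball constant `C₀(SU(N))` of this seat's file 36 (row NE7c, HANDOFF § GEN 16 open point (vi′); [folklore])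

Cell `pub-balaban-gaps` (G2), seat ne8, estimate **NE7c**.  Proof-only file under `Spine/NE7c/`; Mathlib only.  No `def`; 0 `sorry`.

THE PLAN (vi′) (honest; see this seat's file 40 `LiveFactorSUNCentralTube` for the route): B0 transports the `SU(N)` Hilbert–Schmidt ball to a central tube
segment of `U(N)`; B1 squeezes the tube segment, in the `U(N)` Cayley chart, between CYLINDERS `{X₀ + iφ·1 : X₀ ∈ 𝔰𝔲(N), ‖X₀‖_HS ≤ ρ, φ ∈ J}` of the chart
space `𝔼 N ≅ 𝔲(N)` — solid cylinders over the unit direction `e = i·1∕√N` (`‖i·1‖_HS = √N`; `𝔰𝔲(N) = e^⊥`); B2 = THIS FILE computes their volume; B3 assembles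
`C₀(SU(N)) = 2π·c_N·ω_{N²−1}∕√N`.

THIS FILE ([folklore]; an abstract finite-dimensional real inner product space `E` of dimension `n + 1`, a unit vector `e`, `J ⊆ ℝ` measurable):
* `exists_orthonormalBasis_head` — an orthonormal basis `b : Fin (n+1) → E` with `b 0 = e`;
* `norm_sub_inner_smul_sq` — `‖x − ⟪x,e⟫e‖² = Σ_{j} ⟪b j.succ, x⟫²` (Parseval without the head coordinate);
* **`volume_cylinder`** — `volume {x : E | ‖x − ⟪x,e⟫e‖ ≤ ρ ∧ ⟪x,e⟫ ∈ J} = volume J · volume (closedBall (0 : EuclideanSpace ℝ (Fin n)) ρ)` (the coordinate map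
  `x ↦ (⟪e,x⟫, (⟪b j.succ, x⟫)_j)` is `b.repr` followed by `ofLp` and `piFinSuccAbove`, all VOLUME PRESERVING — `OrthonormalBasis.measurePreserving_repr`,
  `PiLp.volume_preserving_ofLp`, `volume_preserving_piFinSuccAbove` — and the cylinder is the preimage of the product `J ×ˢ {z : √(Σ z_j²) ≤ ρ}`);
* **`volume_cylinder_explicit`** — `= volume J · ρ^n · (√π)^n∕Γ(n∕2 + 1)` for `n ≥ 1` (`EuclideanSpace.volume_closedBall`).

HONEST: Mathlib measure theory ([folklore]); nothing of `U(N)`, nothing of Bałaban's; `C₀(SU(N))` is NOT valued in this file.  NE7c NOT proved; WORD UNCHANGED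
(WORK-bound behind node O; INSTANCE 0∕1); spine 0∕9; one finite T⁴ — NOT ℝ⁴, NOT infinite volume, NOT the mass gap, NOT Clay.
-/

set_option autoImplicit false

noncomputable section

open MeasureTheory Set Filter Metric WithLp
open scoped Real ENNReal

namespace Summit.QuantumFields.BalabanUV.T4Continuum.Spine.NE7c.LiveFactorCylinderVolume

variable {E : Type*} [NormedAddCommGroup E] [InnerProductSpace ℝ E] [FiniteDimensional ℝ E] [MeasurableSpace E] [BorelSpace E]

omit [MeasurableSpace E] [BorelSpace E] in
/-- an orthonormal basis of `E` (dimension `n + 1`) whose head is the prescribed unit vector `e`. [folklore] -/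
theorem exists_orthonormalBasis_head {n : ℕ} (hn : Module.finrank ℝ E = n + 1) {e : E} (he : ‖e‖ = 1) :
    ∃ b : OrthonormalBasis (Fin (n + 1)) ℝ E, b 0 = e := by
  have hv : Orthonormal ℝ (({0} : Set (Fin (n + 1))).restrict fun _ : Fin (n + 1) => e) := by
    rw [orthonormal_iff_ite]
    rintro ⟨i, hi⟩ ⟨j, hj⟩
    rw [Set.mem_singleton_iff] at hi hj
    subst hi; subst hj
    simp only [Set.restrict_apply, if_true]
    rw [real_inner_self_eq_norm_sq, he, one_pow]
  obtain ⟨b, hb⟩ := Orthonormal.exists_orthonormalBasis_extension_of_card_eq (𝕜 := ℝ) (E := E)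
    (by rw [hn, Fintype.card_fin]) hv
  exact ⟨b, hb 0 (Set.mem_singleton 0)⟩

omit [FiniteDimensional ℝ E] [MeasurableSpace E] [BorelSpace E] in
/-- head coordinate: `b.repr x 0 = inner ℝ x e`. [folklore] -/
theorem repr_zero_eq_inner {n : ℕ} (b : OrthonormalBasis (Fin (n + 1)) ℝ E) {e : E} (hb : b 0 = e) (x : E) :
    b.repr x 0 = inner ℝ x e := by
  rw [OrthonormalBasis.repr_apply_apply, hb, real_inner_comm]

omit [FiniteDimensional ℝ E] [MeasurableSpace E] [BorelSpace E] in
/-- **PARSEVAL WITHOUT THE HEAD**: `‖x − ⟪x,e⟫_ℝe‖² = Σ_j (b.repr x j.succ)²` for an orthonormal basis with `b 0 = e`. [folklore] -/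
theorem norm_sub_inner_smul_sq {n : ℕ} (b : OrthonormalBasis (Fin (n + 1)) ℝ E) {e : E} (hb : b 0 = e) (x : E) :
    ‖x - inner ℝ x e • e‖ ^ 2 = ∑ j : Fin n, (b.repr x j.succ) ^ 2 := by
  classical
  rw [← b.repr.norm_map, EuclideanSpace.real_norm_sq_eq, Fin.sum_univ_succ]
  have hcoord : ∀ i, b.repr (x - inner ℝ x e • e) i = b.repr x i - inner ℝ x e * (if i = 0 then 1 else 0) := by
    intro i
    rw [map_sub, map_smul, ← hb, b.repr_self]
    simp only [PiLp.sub_apply, PiLp.smul_apply, PiLp.single_apply, smul_eq_mul]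
  simp only [hcoord, if_true, Fin.succ_ne_zero, if_false, mul_one, mul_zero, sub_zero]
  rw [repr_zero_eq_inner b hb, sub_self, zero_pow two_ne_zero, zero_add]

omit [FiniteDimensional ℝ E] [MeasurableSpace E] [BorelSpace E] in
/-- the head-free coordinate vector lies in the `ρ`-ball iff `‖x − ⟪x,e⟫_ℝe‖ ≤ ρ`. [folklore] -/
theorem sqrt_sum_sq_le_iff {n : ℕ} (b : OrthonormalBasis (Fin (n + 1)) ℝ E) {e : E} (hb : b 0 = e) (x : E) (ρ : ℝ) :
    √(∑ j : Fin n, (b.repr x j.succ) ^ 2) ≤ ρ ↔ ‖x - inner ℝ x e • e‖ ≤ ρ := by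
  rw [← norm_sub_inner_smul_sq b hb x, Real.sqrt_sq (norm_nonneg _)]

/-- the Euclidean closed ball of `EuclideanSpace ℝ (Fin n)` in product coordinates. [folklore] -/
theorem preimage_ofLp_ball_eq (n : ℕ) (ρ : ℝ) :
    (@ofLp 2 (Fin n → ℝ)) ⁻¹' {z : Fin n → ℝ | √(∑ j, z j ^ 2) ≤ ρ} = closedBall (0 : EuclideanSpace ℝ (Fin n)) ρ := by
  ext y
  rw [Set.mem_preimage, Set.mem_setOf_eq, mem_closedBall, dist_zero_right, EuclideanSpace.norm_eq]
  simp only [Real.norm_eq_abs, sq_abs]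

/-- the coordinate ball is measurable. [folklore] -/
theorem measurableSet_coordBall (n : ℕ) (ρ : ℝ) : MeasurableSet {z : Fin n → ℝ | √(∑ j, z j ^ 2) ≤ ρ} := by
  refine measurableSet_le ?_ measurable_const
  exact (continuous_finsetSum _ fun j _ => (continuous_apply j).pow 2).sqrt.measurable

/-- **THE VOLUME OF A SOLID CYLINDER**: in a real inner product space of dimension `n + 1`, for a unit vector `e`, any `ρ` and measurable `J ⊆ ℝ`,
`volume {x | ‖x − ⟪x,e⟫_ℝe‖ ≤ ρ ∧ ⟪x,e⟫_ℝ ∈ J} = volume J · volume (closedBall (0 : EuclideanSpace ℝ (Fin n)) ρ)`. [folklore] -/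
theorem volume_cylinder {n : ℕ} (hn : Module.finrank ℝ E = n + 1) {e : E} (he : ‖e‖ = 1) (ρ : ℝ) {J : Set ℝ}
    (hJ : MeasurableSet J) :
    volume {x : E | ‖x - inner ℝ x e • e‖ ≤ ρ ∧ inner ℝ x e ∈ J} = volume J * volume (closedBall (0 : EuclideanSpace ℝ (Fin n)) ρ) := by
  obtain ⟨b, hb⟩ := exists_orthonormalBasis_head hn he
  -- the volume-preserving coordinate map `E → ℝ × (Fin n → ℝ)`
  have hΦ : MeasurePreserving
      (fun x : E => MeasurableEquiv.piFinSuccAbove (fun _ : Fin (n + 1) => ℝ) 0 (ofLp (b.repr x)))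
      volume volume :=
    ((volume_preserving_piFinSuccAbove (fun _ : Fin (n + 1) => ℝ) 0).comp (PiLp.volume_preserving_ofLp (Fin (n + 1)))).comp
      b.measurePreserving_repr
  -- the cylinder is the preimage of the product `J ×ˢ ball`
  have hset : {x : E | ‖x - inner ℝ x e • e‖ ≤ ρ ∧ inner ℝ x e ∈ J}
      = (fun x : E => MeasurableEquiv.piFinSuccAbove (fun _ : Fin (n + 1) => ℝ) 0 (ofLp (b.repr x))) ⁻¹'
          (J ×ˢ {z : Fin n → ℝ | √(∑ j, z j ^ 2) ≤ ρ}) := by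
    ext x
    change (‖x - inner ℝ x e • e‖ ≤ ρ ∧ inner ℝ x e ∈ J) ↔
      (b.repr x 0 ∈ J ∧ (fun j : Fin n => b.repr x (Fin.succAbove 0 j)) ∈ {z : Fin n → ℝ | √(∑ j, z j ^ 2) ≤ ρ})
    simp only [Set.mem_setOf_eq, Fin.succAbove_zero]
    rw [repr_zero_eq_inner b hb x, sqrt_sum_sq_le_iff b hb x ρ, and_comm]
  rw [hset, hΦ.measure_preimage ((hJ.prod (measurableSet_coordBall n ρ)).nullMeasurableSet), Measure.volume_eq_prod, Measure.prod_prod,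
    ← (PiLp.volume_preserving_ofLp (Fin n)).measure_preimage (measurableSet_coordBall n ρ).nullMeasurableSet, preimage_ofLp_ball_eq]

/-- **THE VOLUME OF A SOLID CYLINDER, EXPLICIT**: `= volume J · ρ^n · (√π)^n ∕ Γ(n∕2 + 1)` (Mathlib's `EuclideanSpace.volume_closedBall`). [folklore] -/
theorem volume_cylinder_explicit {n : ℕ} (hn0 : 0 < n) (hn : Module.finrank ℝ E = n + 1) {e : E} (he : ‖e‖ = 1) (ρ : ℝ)
    {J : Set ℝ} (hJ : MeasurableSet J) :
    volume {x : E | ‖x - inner ℝ x e • e‖ ≤ ρ ∧ inner ℝ x e ∈ J}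
      = volume J * (ENNReal.ofReal ρ ^ n * ENNReal.ofReal (√π ^ n / Real.Gamma (n / 2 + 1))) := by
  haveI : Nonempty (Fin n) := Fin.pos_iff_nonempty.1 hn0
  rw [volume_cylinder hn he ρ hJ, EuclideanSpace.volume_closedBall, Fintype.card_fin]

end Summit.QuantumFields.BalabanUV.T4Continuum.Spine.NE7c.LiveFactorCylinderVolume
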